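import Literature.Topology.FourManifolds.FramingPhaseCorrection
import Literature.Topology.FourManifolds.BraidFramingEstimates
import Literature.Topology.FourManifolds.TorusLocalBumps
import Literature.Topology.FourManifolds.BraidedTorusSheet
import HarnessLib

/-!
# The framing functions on the two parameter tori of `Σ̄₂`

Topic `Literature/Topology/FourManifolds` (fact seat of the Seiberg–Witten leaf
`Literature.Barriers.SmoothPoincare4.akhmedovPark2010_lemma8_invariants`; block 2 of
Akhmedov–Park's `X₁(m)`, A. Akhmedov, B. D. Park, Invent. Math. 181 (2010), §3).  The assembled
tube of `Σ̄₂ ⊂ T⁴ # ℂℙ²bar` needs, on each of the two parameter tori, a smooth UNIT framing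
function on the complement of the two plumbing parameters which is EXACTLY a prescribed unit
direction (the normalised plumbing-coordinate direction, or its conjugate) on a box around each
of them.  They are obtained from the reference framings of `BraidFramingEstimates.lean` by two
phase corrections (`FramingPhaseCorrection.lean`) localised by product bumps
(`TorusLocalBumps.lean`):

* `exists_two_point_framing` — the generic two-step correction (any manifold);
* `exists_axisFraming` — the axis torus `T′ ∋ (σ, τ)` of the braided sheet: smooth of norm one
  off `(1, 1)`, `(-1, 1)`, `= conj b̂` on `{Re σ ≥ 0.97, Re τ ≥ 0.97} ∖ {(1, 1)}` and `= b̂` on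
  `{Re σ ≤ -0.97, Re τ ≥ 0.97} ∖ {(-1, 1)}` (`b = Im σ²/Re σ² + i Im τ/Re τ`);
* `exists_firstTorusFraming` — the first torus `T ∋ (z₁, z₂)`: smooth of norm one off
  `x₂ = (1, 1)`, `x₃ = (ϑ⁻², 1)` (`ϑ = e^{i r₀}`, `0 < r₀ ≤ 1/8`), `= conj â` on the box of
  angular size `sin² r₀ / 80` at `x₂` and `= â′` on the box at `x₃` (`a`, `a′` the quarter-chart
  directions).

The coordinate functions and directions enter as variables with their defining equations, the
form in which the assembly uses them.  Everything is proved; no definitions.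

## References

* A. Akhmedov, B. D. Park, Invent. Math. 181 (2010) 577–603 = arXiv:math/0701829, §3. [AkhmedovPark2010]
* R. C. Kirby, *The Topology of 4-Manifolds*, LNM 1374 (1989), Ch. IV. [Kirby1989]
-/

noncomputable section

open scoped Manifold ContDiff Topology ComplexConjugate Real
open Set Function Complex
open Literature.Geometry.Manifold (Rechart)

namespace Literature.Topology.FourManifolds

/-! ### §1 Two-point phase correction (generic) -/

section TwoPoint

variable {E : Type*} [NormedAddCommGroup E] [NormedSpace ℝ E] {H : Type*} [TopologicalSpace H]
  {IM : ModelWithCorners ℝ E H} {M : Type*} [TopologicalSpace M] [ChartedSpace H M]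

/-- **Two-point phase correction.**  A unit reference `Φ` on `S`, targets `uP` on `VP` and `uN`
on `VN` within `90°` (up to constant phases `αP`, `αN`) of `Φ`, bumps `βP`, `βN` supported (within
`S`) in `VP`, `VN` with `VN ∩ tsupport βP = ∅`, give a unit `φ` on `S` equal to `uP` where
`βP = 1` (off `tsupport βN`) and to `uN` where `βN = 1`. [cite: Kirby1989, Ch. IV] -/
theorem exists_two_point_framing {Φ uP uN : M → ℂ} {S VP VN : Set M} (hVP : IsOpen VP)
    (hVN : IsOpen VN) (hVPS : VP ⊆ S) (hVNS : VN ⊆ S)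
    (hΦ : ContMDiffOn IM 𝓘(ℝ, ℂ) ∞ Φ S) (hΦ1 : ∀ x ∈ S, ‖Φ x‖ = 1)
    (huP : ContMDiffOn IM 𝓘(ℝ, ℂ) ∞ uP VP) (huP1 : ∀ x ∈ VP, ‖uP x‖ = 1) (αP : ℝ)
    (hreP : ∀ x ∈ VP, 0 < (uP x * conj (Φ x) * Complex.exp (-(αP * I))).re)
    (huN : ContMDiffOn IM 𝓘(ℝ, ℂ) ∞ uN VN) (huN1 : ∀ x ∈ VN, ‖uN x‖ = 1) (αN : ℝ)
    (hreN : ∀ x ∈ VN, 0 < (uN x * conj (Φ x) * Complex.exp (-(αN * I))).re)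
    {βP βN : M → ℝ} (hβP : ContMDiff IM 𝓘(ℝ, ℝ) ∞ βP) (hβN : ContMDiff IM 𝓘(ℝ, ℝ) ∞ βN)
    (hβPV : ∀ x ∈ S, x ∈ tsupport βP → x ∈ VP) (hβNV : ∀ x ∈ S, x ∈ tsupport βN → x ∈ VN)
    (hdisj : ∀ x ∈ VN, x ∉ tsupport βP) :
    ∃ φ : M → ℂ, ContMDiffOn IM 𝓘(ℝ, ℂ) ∞ φ S ∧ (∀ x ∈ S, ‖φ x‖ = 1) ∧
      (∀ x ∈ VP, βP x = 1 → x ∉ tsupport βN → φ x = uP x) ∧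
      (∀ x ∈ VN, βN x = 1 → φ x = uN x) ∧
      (∀ x ∈ S, x ∉ tsupport βP → x ∉ tsupport βN → φ x = Φ x) := by
  obtain ⟨φ₁, hφ₁, hφ₁1, hφ₁u, -, hφ₁Φ⟩ :=
    FramingCorrection.exists_unit_framing_correction hVP hVPS hΦ huP hΦ1 huP1 αP hreP hβP hβPV
  have hre' : ∀ x ∈ VN, 0 < (uN x * conj (φ₁ x) * Complex.exp (-(αN * I))).re := fun x hx => by
    rw [hφ₁Φ x (hVNS hx) (hdisj x hx)]; exact hreN x hx
  obtain ⟨φ₂, hφ₂, hφ₂1, hφ₂u, -, hφ₂Φ⟩ :=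
    FramingCorrection.exists_unit_framing_correction hVN hVNS hφ₁ huN hφ₁1 huN1 αN hre' hβN hβNV
  refine ⟨φ₂, hφ₂, hφ₂1, fun x hx h1 h2 => ?_, hφ₂u, fun x hx hP hN => ?_⟩
  · rw [hφ₂Φ x (hVPS hx) h2, hφ₁u x hx h1]
  · rw [hφ₂Φ x hx hN, hφ₁Φ x hx hP]

end TwoPoint

/-! ### §2 The axis torus -/

section Axis

variable {f : ModelProd (EuclideanSpace ℝ (Fin 1)) (EuclideanSpace ℝ (Fin 1)) ≃ₜ EuclideanSpace ℝ (Fin 2)}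

/-- Unit vectors: `‖z/‖z‖‖ = 1`, and the algebra `conj ẑ · conj ŵ = ‖z w‖⁻¹ conj (z w)`,
`ẑ · conj ŵ = ‖z w‖⁻¹ (z conj w)` used to turn the quadrant estimates into phase conditions.
[folklore] -/
theorem unit_mul_facts {z w : ℂ} (hz : z ≠ 0) :
    ‖((‖z‖⁻¹ : ℝ) : ℂ) * z‖ = 1 ∧
    conj (((‖z‖⁻¹ : ℝ) : ℂ) * z) * conj (((‖w‖⁻¹ : ℝ) : ℂ) * w) =
      (((‖z‖ * ‖w‖)⁻¹ : ℝ) : ℂ) * conj (z * w) ∧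
    (((‖z‖⁻¹ : ℝ) : ℂ) * z) * conj (((‖w‖⁻¹ : ℝ) : ℂ) * w) =
      (((‖z‖ * ‖w‖)⁻¹ : ℝ) : ℂ) * (z * conj w) := by
  refine ⟨?_, ?_, ?_⟩
  · rw [norm_mul, Complex.norm_real, norm_inv, norm_norm, inv_mul_cancel₀ (norm_ne_zero_iff.2 hz)]
  · rw [map_mul, map_mul, Complex.conj_ofReal, Complex.conj_ofReal, map_mul, mul_inv,
      Complex.ofReal_mul]; ring
  · rw [map_mul, Complex.conj_ofReal, mul_inv, Complex.ofReal_mul]; ring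

/-- **The framing function of the braid-axis torus.**  For the torus `T′ = Rechart f (S¹ × S¹)`
with coordinates `σ`, `τ` (`(σ, τ) = out w`) and direction
`b₀ = Im σ²/Re σ² + i Im τ/Re τ`, there is `φ : T′ → ℂ`, smooth of norm one on the complement of
the two points `(σ, τ) = (1, 1)`, `(-1, 1)`, with `φ = conj b̂₀` on
`{Re σ ≥ 0.97, Re τ ≥ 0.97} ∖ {(1, 1)}` and `φ = b̂₀` on `{Re σ ≤ -0.97, Re τ ≥ 0.97} ∖ {(-1, 1)}`.
[cite: AkhmedovPark2010, §3] [cite: Kirby1989, Ch. IV] -/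
theorem exists_axisFraming (hf : ContMDiff ((𝓡 1).prod (𝓡 1)) 𝓘(ℝ, EuclideanSpace ℝ (Fin 2)) ∞ f)
    (hf' : ContMDiff 𝓘(ℝ, EuclideanSpace ℝ (Fin 2)) ((𝓡 1).prod (𝓡 1)) ∞ f.symm)
    {σ τ : Rechart f (Circle × Circle) → Circle}
    (hσ : ∀ w, σ w = (Rechart.out f (Circle × Circle) w).1)
    (hτ : ∀ w, τ w = (Rechart.out f (Circle × Circle) w).2)
    {b₀ : Rechart f (Circle × Circle) → ℂ}
    (hb₀ : ∀ w, b₀ w = (((((σ w : ℂ)) ^ 2).im / (((σ w : ℂ)) ^ 2).re : ℝ) : ℂ) +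
      ((((τ w : ℂ).im / (τ w : ℂ).re : ℝ)) : ℂ) * I) :
    ∃ φ : Rechart f (Circle × Circle) → ℂ,
      ContMDiffOn (𝓡 2) 𝓘(ℝ, ℂ) ∞ φ
        {w | ¬ (σ w = 1 ∧ τ w = 1) ∧ ¬ (((σ w : Circle) : ℂ) = -1 ∧ τ w = 1)} ∧
      (∀ w, ¬ (σ w = 1 ∧ τ w = 1) → ¬ (((σ w : Circle) : ℂ) = -1 ∧ τ w = 1) → ‖φ w‖ = 1) ∧
      (∀ w, 97 / 100 ≤ (σ w : ℂ).re → 97 / 100 ≤ (τ w : ℂ).re → ¬ (σ w = 1 ∧ τ w = 1) →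
        φ w = conj (((‖b₀ w‖⁻¹ : ℝ) : ℂ) * b₀ w)) ∧
      (∀ w, (σ w : ℂ).re ≤ -(97 / 100) → 97 / 100 ≤ (τ w : ℂ).re →
        ¬ (((σ w : Circle) : ℂ) = -1 ∧ τ w = 1) → φ w = ((‖b₀ w‖⁻¹ : ℝ) : ℂ) * b₀ w) := by
  haveI hT : IsManifold (𝓡 2) ∞ (Rechart f (Circle × Circle)) := Rechart.isManifold f _ hf hf'
  haveI : Fact (Module.finrank ℝ ℂ = 1 + 1) := finrank_real_complex_fact'
  -- the reference framing and the punctured torus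
  set g : Rechart f (Circle × Circle) → ℂ := fun w => ((τ w : ℂ) - 1) - (((σ w : ℂ).im : ℝ) : ℂ) with hg
  let unit : ℂ → ℂ := fun z => ((‖z‖⁻¹ : ℝ) : ℂ) * z
  set S : Set (Rechart f (Circle × Circle)) :=
    {w | ¬ (σ w = 1 ∧ τ w = 1) ∧ ¬ (((σ w : Circle) : ℂ) = -1 ∧ τ w = 1)} with hS
  -- smoothness of the coordinates
  have hout : ContMDiff (𝓡 2) ((𝓡 1).prod (𝓡 1)) ∞ (Rechart.out f (Circle × Circle)) :=
    Rechart.contMDiff_out f _ hf hf'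
  have hcoe : ContMDiff (𝓡 1) 𝓘(ℝ, ℂ) ∞ (fun z : Circle => (z : ℂ)) := contMDiff_coe_sphere
  have hσc : ContMDiff (𝓡 2) 𝓘(ℝ, ℂ) ∞ fun w => (σ w : ℂ) := by
    have : (fun w => (σ w : ℂ)) =
        (fun z : Circle => (z : ℂ)) ∘ Prod.fst ∘ Rechart.out f (Circle × Circle) := by
      funext w; simp only [Function.comp_apply, hσ w]
    rw [this]; exact hcoe.comp (contMDiff_fst.comp hout)
  have hτc : ContMDiff (𝓡 2) 𝓘(ℝ, ℂ) ∞ fun w => (τ w : ℂ) := by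
    have : (fun w => (τ w : ℂ)) =
        (fun z : Circle => (z : ℂ)) ∘ Prod.snd ∘ Rechart.out f (Circle × Circle) := by
      funext w; simp only [Function.comp_apply, hτ w]
    rw [this]; exact hcoe.comp (contMDiff_snd.comp hout)
  have hofReal : ContMDiff 𝓘(ℝ, ℝ) 𝓘(ℝ, ℂ) ∞ (fun t : ℝ => (t : ℂ)) := Complex.ofRealCLM.contMDiff
  have hgs : ContMDiff (𝓡 2) 𝓘(ℝ, ℂ) ∞ g := by
    have h1 : ContMDiff (𝓡 2) 𝓘(ℝ, ℝ) ∞ fun w => (σ w : ℂ).im := Complex.imCLM.contMDiff.comp hσc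
    exact (hτc.sub contMDiff_const).sub (hofReal.comp h1)
  -- the zero set of `g` is the pair of points
  have hg0 : ∀ w, g w = 0 ↔ ¬ (w ∈ S) := fun w => by
    show ((τ w : ℂ) - 1) - (((σ w : ℂ).im : ℝ) : ℂ) = 0 ↔ ¬ (w ∈ S)
    rw [BraidFraming.refFramingAxis_eq_zero_iff]
    simp only [hS, mem_setOf_eq]
    constructor
    · rintro ⟨h1, h2 | h2⟩ ⟨h3, h4⟩
      · exact h3 ⟨Circle.ext (by rw [h2, Circle.coe_one]), h1⟩
      · exact h4 ⟨h2, h1⟩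
    · intro h
      by_contra h'
      refine h ⟨fun h3 => h' ⟨h3.2, Or.inl ?_⟩, fun h3 => h' ⟨h3.2, Or.inr h3.1⟩⟩
      rw [h3.1, Circle.coe_one]
  have hgne : ∀ w ∈ S, g w ≠ 0 := fun w hw h => (hg0 w).1 h hw
  -- the reference unit framing
  have hΦ : ContMDiffOn (𝓡 2) 𝓘(ℝ, ℂ) ∞ (fun w => unit (g w)) S := fun w hw =>
    ((BraidedTorus.contDiffAt_unit (hgne w hw)).comp_contMDiffWithinAt (hgs w).contMDiffWithinAt)
  have hΦ1 : ∀ w ∈ S, ‖unit (g w)‖ = 1 := fun w hw => (unit_mul_facts (w := g w) (hgne w hw)).1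
  -- the direction `b₀`: smooth where `Re σ² ≠ 0`, `Re τ ≠ 0`
  have hdiv : ContDiffOn ℝ ∞ (fun w : ℂ => w.im / w.re) {w : ℂ | w.re ≠ 0} :=
    Complex.imCLM.contDiff.contDiffOn.div Complex.reCLM.contDiff.contDiffOn fun w hw => hw
  have hmulI : ContMDiff 𝓘(ℝ, ℝ) 𝓘(ℝ, ℂ) ∞ (fun t : ℝ => (t : ℂ) * I) :=
    (Complex.ofRealCLM.contDiff.mul contDiff_const).contMDiff
  have hsqC : ContDiff ℝ ∞ fun z : ℂ => z ^ 2 := contDiff_id.pow 2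
  set B : Set (Rechart f (Circle × Circle)) :=
    {w | (((σ w : ℂ)) ^ 2).re ≠ 0 ∧ ((τ w : ℂ)).re ≠ 0} with hB
  have hb₀s : ContMDiffOn (𝓡 2) 𝓘(ℝ, ℂ) ∞ b₀ B := by
    have h1 : ContMDiffOn (𝓡 2) 𝓘(ℝ, ℝ) ∞
        (fun w => (((σ w : ℂ)) ^ 2).im / (((σ w : ℂ)) ^ 2).re) B :=
      hdiv.contMDiffOn.comp (hsqC.comp_contMDiff hσc).contMDiffOn fun w hw => hw.1
    have h2 : ContMDiffOn (𝓡 2) 𝓘(ℝ, ℝ) ∞ (fun w => ((τ w : ℂ)).im / ((τ w : ℂ)).re) B :=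
      hdiv.contMDiffOn.comp hτc.contMDiffOn fun w hw => hw.2
    exact ((hofReal.comp_contMDiffOn h1).add (hmulI.comp_contMDiffOn h2)).congr fun w _ => hb₀ w
  -- real and imaginary parts of `b₀`, and its zeros
  have hb₀re : ∀ w, (b₀ w).re = (((σ w : ℂ)) ^ 2).im / (((σ w : ℂ)) ^ 2).re ∧
      (b₀ w).im = ((τ w : ℂ)).im / ((τ w : ℂ)).re := fun w => by
    rw [hb₀ w]; constructor <;> simp
  have hσ1 : ∀ w, (σ w : ℂ).re ^ 2 + (σ w : ℂ).im ^ 2 = 1 := fun w => BraidFraming.re_sq_add_im_sq _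
  have hτ1 : ∀ w, (τ w : ℂ).re ^ 2 + (τ w : ℂ).im ^ 2 = 1 := fun w => BraidFraming.re_sq_add_im_sq _
  have hb₀ne : ∀ w, 9 / 10 < |(σ w : ℂ).re| → 0 < (τ w : ℂ).re → b₀ w = 0 →
      (σ w : ℂ).im = 0 ∧ (τ w : ℂ).im = 0 := fun w hσw hτw h => by
    obtain ⟨hre, him⟩ := hb₀re w
    rw [h, Complex.zero_re] at hre
    rw [h, Complex.zero_im] at him
    have hX : 0 < (((σ w : ℂ)) ^ 2).re := by
      rw [BraidFraming.sq_re]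
      have := hσ1 w
      have habs : (σ w : ℂ).re ^ 2 = |(σ w : ℂ).re| ^ 2 := (sq_abs _).symm
      nlinarith
    have h1 : (((σ w : ℂ)) ^ 2).im = 0 := by
      rcases div_eq_zero_iff.1 hre.symm with h | h
      · exact h
      · exact absurd h hX.ne'
    have h2 : ((τ w : ℂ)).im = 0 := by
      rcases div_eq_zero_iff.1 him.symm with h | h
      · exact h
      · exact absurd h hτw.ne'
    rw [BraidFraming.sq_im] at h1
    have hσ0 : (σ w : ℂ).re ≠ 0 := fun h0 => by rw [h0, abs_zero] at hσw; linarith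
    refine ⟨?_, h2⟩
    rcases mul_eq_zero.1 h1 with h | h
    · rcases mul_eq_zero.1 h with h' | h'
      · norm_num at h'
      · exact absurd h' hσ0
    · exact h
  -- `S` is open
  have hSo : IsOpen S := by
    have : S = g ⁻¹' {0}ᶜ := by
      ext w
      simp only [mem_preimage, mem_compl_iff, mem_singleton_iff]
      constructor
      · exact fun hw h => (hg0 w).1 h hw
      · intro h; by_contra hw; exact h ((hg0 w).2 hw)
    rw [this]
    exact isOpen_compl_singleton.preimage hgs.continuous
  -- the two boxes
  have hreσ : Continuous fun w => (σ w : ℂ).re := Complex.continuous_re.comp hσc.continuous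
  have hreτ : Continuous fun w => (τ w : ℂ).re := Complex.continuous_re.comp hτc.continuous
  set VP : Set (Rechart f (Circle × Circle)) :=
    {w | 19 / 20 < (σ w : ℂ).re ∧ 19 / 20 < (τ w : ℂ).re} ∩ S with hVP
  set VN : Set (Rechart f (Circle × Circle)) :=
    {w | (σ w : ℂ).re < -(19 / 20) ∧ 19 / 20 < (τ w : ℂ).re} ∩ S with hVN
  have hVPo : IsOpen VP :=
    ((isOpen_lt continuous_const hreσ).inter (isOpen_lt continuous_const hreτ)).inter hSo
  have hVNo : IsOpen VN :=
    ((isOpen_lt hreσ continuous_const).inter (isOpen_lt continuous_const hreτ)).inter hSo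
  have hVPB : VP ⊆ B := by
    rintro w ⟨⟨h1, h2⟩, -⟩
    refine ⟨ne_of_gt ?_, ne_of_gt (by linarith)⟩
    rw [BraidFraming.sq_re]; nlinarith [hσ1 w]
  have hVNB : VN ⊆ B := by
    rintro w ⟨⟨h1, h2⟩, -⟩
    refine ⟨ne_of_gt ?_, ne_of_gt (by linarith)⟩
    rw [BraidFraming.sq_re]; nlinarith [hσ1 w]
  have hb₀VP : ∀ w ∈ VP, b₀ w ≠ 0 := by
    rintro w ⟨⟨h1, h2⟩, hwS⟩ h0
    obtain ⟨hi1, hi2⟩ := hb₀ne w (by rw [abs_of_pos (by linarith)]; linarith) (by linarith) h0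
    exact hwS.1 ⟨BraidFraming.eq_one_of_im_eq_zero hi1 (by linarith),
      BraidFraming.eq_one_of_im_eq_zero hi2 (by linarith)⟩
  have hb₀VN : ∀ w ∈ VN, b₀ w ≠ 0 := by
    rintro w ⟨⟨h1, h2⟩, hwS⟩ h0
    obtain ⟨hi1, hi2⟩ := hb₀ne w (by rw [abs_of_neg (by linarith)]; linarith) (by linarith) h0
    exact hwS.2 ⟨BraidFraming.coe_eq_neg_one_of_im_eq_zero hi1 (by linarith),
      BraidFraming.eq_one_of_im_eq_zero hi2 (by linarith)⟩
  -- the targets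
  have hunit : ∀ {z : ℂ}, z ≠ 0 → ContDiffAt ℝ ∞ unit z := fun hz => BraidedTorus.contDiffAt_unit hz
  have huP : ContMDiffOn (𝓡 2) 𝓘(ℝ, ℂ) ∞ (fun w => conj (unit (b₀ w))) VP := fun w hw =>
    (Complex.conjCLE.contDiff.contDiffAt.comp _ (hunit (hb₀VP w hw))).comp_contMDiffWithinAt
      ((hb₀s w (hVPB hw)).mono hVPB)
  have huN : ContMDiffOn (𝓡 2) 𝓘(ℝ, ℂ) ∞ (fun w => unit (b₀ w)) VN := fun w hw =>
    (hunit (hb₀VN w hw)).comp_contMDiffWithinAt ((hb₀s w (hVNB hw)).mono hVNB)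
  have huP1 : ∀ w ∈ VP, ‖conj (unit (b₀ w))‖ = 1 := fun w hw => by
    rw [Complex.norm_conj]; exact (unit_mul_facts (w := b₀ w) (hb₀VP w hw)).1
  have huN1 : ∀ w ∈ VN, ‖unit (b₀ w)‖ = 1 := fun w hw =>
    (unit_mul_facts (w := b₀ w) (hb₀VN w hw)).1
  -- the phase conditions from the quadrant estimates
  have hexpπ : Complex.exp (-(π * I)) = -1 := by
    rw [Complex.exp_neg, Complex.exp_pi_mul_I]; norm_num
  have hreP : ∀ w ∈ VP, 0 < (conj (unit (b₀ w)) * conj (unit (g w)) * Complex.exp (-(π * I))).re := by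
    rintro w ⟨⟨h1, h2⟩, hwS⟩
    have hb := hb₀VP w ⟨⟨h1, h2⟩, hwS⟩
    have hgw := hgne w hwS
    obtain ⟨-, hconj, -⟩ := unit_mul_facts (w := g w) hb
    have hE := BraidFraming.re_axisCoord_mul_refFraming_neg (σ := σ w) (τ := τ w)
      (by linarith) (by linarith) hwS.1
    have hE' : (b₀ w * g w).re < 0 := by rw [hb₀ w]; exact hE
    rw [hexpπ, hconj, mul_neg_one, Complex.neg_re, Complex.re_ofReal_mul, Complex.conj_re]
    have hpos : 0 < (‖b₀ w‖ * ‖g w‖)⁻¹ :=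
      inv_pos.2 (mul_pos (norm_pos_iff.2 hb) (norm_pos_iff.2 hgw))
    have : (‖b₀ w‖ * ‖g w‖)⁻¹ * (b₀ w * g w).re < 0 := mul_neg_of_pos_of_neg hpos hE'
    linarith
  have hreN : ∀ w ∈ VN, 0 < (unit (b₀ w) * conj (unit (g w)) * Complex.exp (-(0 * I))).re := by
    rintro w ⟨⟨h1, h2⟩, hwS⟩
    have hb := hb₀VN w ⟨⟨h1, h2⟩, hwS⟩
    have hgw := hgne w hwS
    obtain ⟨-, -, hmul⟩ := unit_mul_facts (w := g w) hb
    have hE := BraidFraming.re_axisCoord_mul_conj_refFraming_pos (σ := σ w) (τ := τ w)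
      (by linarith) (by linarith) hwS.2
    have hE' : 0 < (b₀ w * conj (g w)).re := by rw [hb₀ w]; exact hE
    rw [zero_mul, neg_zero, Complex.exp_zero, mul_one, hmul, Complex.re_ofReal_mul]
    have hpos : 0 < (‖b₀ w‖ * ‖g w‖)⁻¹ :=
      inv_pos.2 (mul_pos (norm_pos_iff.2 hb) (norm_pos_iff.2 hgw))
    exact mul_pos hpos hE'
  -- the bumps
  set σN : Circle := Circle.exp π with hσNdef
  have hσN : (σN : ℂ) = -1 := by rw [hσNdef, Circle.coe_exp, Complex.exp_pi_mul_I]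
  have hre1 : ∀ w, ((((Rechart.out f (Circle × Circle) w).1 * (1 : Circle)⁻¹ : Circle)) : ℂ).re =
      (σ w : ℂ).re ∧
      ((((Rechart.out f (Circle × Circle) w).2 * (1 : Circle)⁻¹ : Circle)) : ℂ).re = (τ w : ℂ).re :=
    fun w => by rw [inv_one, mul_one, mul_one, hσ w, hτ w]; exact ⟨rfl, rfl⟩
  have hre2 : ∀ w, ((((Rechart.out f (Circle × Circle) w).1 * σN⁻¹ : Circle)) : ℂ).re =
      -(σ w : ℂ).re ∧
      ((((Rechart.out f (Circle × Circle) w).2 * (1 : Circle)⁻¹ : Circle)) : ℂ).re = (τ w : ℂ).re :=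
    fun w => by
      constructor
      · rw [Circle.coe_mul, Circle.coe_inv_eq_conj, hσN, map_neg, map_one, mul_neg, mul_one,
          Complex.neg_re, hσ w]
      · rw [inv_one, mul_one, hτ w]
  obtain ⟨βP, hβP, -, hβP1, -, hβPs⟩ := exists_torusBump hf hf' (1 : Circle) (1 : Circle)
    (cin := 97 / 100) (cout := 96 / 100) (by norm_num)
  obtain ⟨βN, hβN, -, hβN1, -, hβNs⟩ := exists_torusBump hf hf' σN (1 : Circle)
    (cin := 97 / 100) (cout := 96 / 100) (by norm_num)
  have hβPs' : ∀ w ∈ tsupport βP, 96 / 100 ≤ (σ w : ℂ).re ∧ 96 / 100 ≤ (τ w : ℂ).re := fun w hw => by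
    obtain ⟨h1, h2⟩ := hβPs hw
    obtain ⟨e1, e2⟩ := hre1 w
    exact ⟨by rwa [e1] at h1, by rwa [e2] at h2⟩
  have hβNs' : ∀ w ∈ tsupport βN, (σ w : ℂ).re ≤ -(96 / 100) ∧ 96 / 100 ≤ (τ w : ℂ).re :=
    fun w hw => by
      obtain ⟨h1, h2⟩ := hβNs hw
      obtain ⟨e1, e2⟩ := hre2 w
      rw [e1] at h1; rw [e2] at h2
      exact ⟨by linarith, h2⟩
  have hβPV : ∀ w ∈ S, w ∈ tsupport βP → w ∈ VP := fun w hw hw' => by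
    obtain ⟨h1, h2⟩ := hβPs' w hw'
    exact ⟨⟨by linarith, by linarith⟩, hw⟩
  have hβNV : ∀ w ∈ S, w ∈ tsupport βN → w ∈ VN := fun w hw hw' => by
    obtain ⟨h1, h2⟩ := hβNs' w hw'
    exact ⟨⟨by linarith, by linarith⟩, hw⟩
  have hdisjβ : ∀ w ∈ VN, w ∉ tsupport βP := by
    rintro w ⟨⟨h1, -⟩, -⟩ hw
    have := (hβPs' w hw).1
    linarith
  -- the two-point correction
  obtain ⟨φ, hφ, hφ1, hφP, hφN, -⟩ := exists_two_point_framing (IM := 𝓡 2) hVPo hVNo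
    inter_subset_right inter_subset_right hΦ hΦ1 huP huP1 π hreP huN huN1 0 hreN hβP hβN
    hβPV hβNV hdisjβ
  refine ⟨φ, hφ, fun w h1 h2 => hφ1 w ⟨h1, h2⟩, fun w h1 h2 hne => ?_, fun w h1 h2 hne => ?_⟩
  · -- the `(1, 1)` box
    have hwS : w ∈ S := by
      refine ⟨hne, fun h => ?_⟩
      have : (σ w : ℂ).re = -1 := by rw [h.1]; simp
      linarith
    have hwV : w ∈ VP := ⟨⟨by linarith, by linarith⟩, hwS⟩
    obtain ⟨e1, e2⟩ := hre1 w
    have hβ : βP w = 1 := hβP1 w (by rw [e1]; exact h1) (by rw [e2]; exact h2)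
    have hnt : w ∉ tsupport βN := fun h => by have := (hβNs' w h).1; linarith
    exact hφP w hwV hβ hnt
  · -- the `(-1, 1)` box
    have hwS : w ∈ S := by
      refine ⟨fun h => ?_, hne⟩
      have : (σ w : ℂ).re = 1 := by rw [h.1]; simp
      linarith
    have hwV : w ∈ VN := ⟨⟨by linarith, by linarith⟩, hwS⟩
    obtain ⟨e1, e2⟩ := hre2 w
    have hβ : βN w = 1 := hβN1 w (by rw [e1]; linarith) (by rw [e2]; exact h2)
    exact hφN w hwV hβ

end Axis

/-! ### §3 The first torus -/

section First

variable {f : ModelProd (EuclideanSpace ℝ (Fin 1)) (EuclideanSpace ℝ (Fin 1)) ≃ₜ EuclideanSpace ℝ (Fin 2)}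

/-- Elementary trigonometry of the small angle `r₀ ∈ (0, 1/8]`: with `S = sin r₀`, `C = cos r₀`,
`ϑ = e^{i r₀}`: `0 < S ≤ 1/8`, `99/100 ≤ C ≤ 1`, the components of `ϑ`, `ϑ²`. [folklore] -/
theorem smallAngle_facts {r₀ : ℝ} (hr₀ : 0 < r₀) (hr₀' : r₀ ≤ 1 / 8) :
    0 < Real.sin r₀ ∧ Real.sin r₀ ≤ 1 / 8 ∧ 99 / 100 ≤ Real.cos r₀ ∧ Real.cos r₀ ≤ 1 ∧
      ((Circle.exp r₀ : Circle) : ℂ).re = Real.cos r₀ ∧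
      ((Circle.exp r₀ : Circle) : ℂ).im = Real.sin r₀ ∧
      (((Circle.exp r₀ ^ 2 : Circle)) : ℂ).re = 1 - 2 * Real.sin r₀ ^ 2 ∧
      (((Circle.exp r₀ ^ 2 : Circle)) : ℂ).im = 2 * Real.sin r₀ * Real.cos r₀ := by
  have hπ := Real.pi_gt_three
  have hS : 0 < Real.sin r₀ := Real.sin_pos_of_pos_of_lt_pi hr₀ (by linarith)
  have hSle : Real.sin r₀ ≤ 1 / 8 := (Real.sin_lt hr₀).le.trans hr₀'
  have hC : 99 / 100 ≤ Real.cos r₀ := by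
    have := Real.one_sub_sq_div_two_le_cos (x := r₀)
    nlinarith
  obtain ⟨hre, him⟩ := BraidFraming.coe_circleExp_re_im r₀
  have h2 : ((Circle.exp r₀ ^ 2 : Circle) : ℂ) = ((Circle.exp (2 * r₀) : Circle) : ℂ) := by
    rw [sq, ← Circle.exp_add, two_mul]
  obtain ⟨hre2, him2⟩ := BraidFraming.coe_circleExp_re_im (2 * r₀)
  refine ⟨hS, hSle, hC, Real.cos_le_one r₀, hre, him, ?_, ?_⟩
  · rw [h2, hre2, Real.cos_two_mul]
    nlinarith [Real.sin_sq_add_cos_sq r₀]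
  · rw [h2, him2, Real.sin_two_mul]

/-- Near `x₂` one is not at `x₃ = (ϑ⁻², 1)`: `Re ϑ⁻² = 1 - 2 sin² r₀ < 1 - sin² r₀ / 80`. [folklore] -/
theorem not_third_point_of_re_ge {ϑ z₁ z₂ : Circle} {Sr : ℝ} (hS : 0 < Sr)
    (hϑ2re : (((ϑ ^ 2 : Circle)) : ℂ).re = 1 - 2 * Sr ^ 2) (h1 : 1 - Sr ^ 2 / 80 ≤ (z₁ : ℂ).re) :
    ¬ (z₁ = ϑ⁻¹ ^ 2 ∧ z₂ = 1) := fun h => by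
  have : (z₁ : ℂ).re = 1 - 2 * Sr ^ 2 := by
    rw [h.1, inv_pow, Circle.coe_inv_eq_conj, Complex.conj_re, hϑ2re]
  nlinarith [mul_pos hS hS]

/-- Near `x₃` one is not at `x₂ = (1, 1)` (in the variable `ζ = z₁ ϑ²`). [folklore] -/
theorem not_second_point_of_re_ge {ϑ z₁ z₂ ζ : Circle} {Sr : ℝ} (hS : 0 < Sr)
    (hϑ2re : (((ϑ ^ 2 : Circle)) : ℂ).re = 1 - 2 * Sr ^ 2) (hζ : ζ = z₁ * ϑ ^ 2)
    (h1 : 1 - Sr ^ 2 / 80 ≤ (ζ : ℂ).re) : ¬ (z₁ = 1 ∧ z₂ = 1) := fun h => by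
  have : (ζ : ℂ).re = 1 - 2 * Sr ^ 2 := by rw [hζ, h.1, one_mul, hϑ2re]
  nlinarith [mul_pos hS hS]

/-- The arithmetic separating the `x₂` box from the `x₃` bump: with `S = sin r₀ ≤ 1/8`,
`C = cos r₀ ≤ 1`, `Re z₁ ≤ 1`, `|Im z₁| < S/4`, the rotated real part
`Re ζ = Re z₁ (1 - 2S²) - Im z₁ (2 S C)` is `< 1 - S²/40`. [folklore] -/
theorem far_from_third_arith {S C x y xζ : ℝ} (hS : 0 < S) (hS8 : S ≤ 1 / 8) (hC : 0 ≤ C)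
    (hC1 : C ≤ 1) (hx1 : x ≤ 1) (hy : |y| < S / 4)
    (hxζ : xζ = x * (1 - 2 * S ^ 2) - y * (2 * S * C)) (hz : 1 - S ^ 2 / 40 ≤ xζ) : False := by
  have h2S : 0 < 1 - 2 * S ^ 2 := by nlinarith
  have hA : x * (1 - 2 * S ^ 2) ≤ 1 * (1 - 2 * S ^ 2) := mul_le_mul_of_nonneg_right hx1 h2S.le
  have hy' := (abs_lt.1 hy).1
  have hB : -y * (2 * S * C) ≤ S / 4 * (2 * S * C) :=
    mul_le_mul_of_nonneg_right (by linarith) (mul_nonneg (by linarith) hC)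
  have hC' : S ^ 2 * C ≤ S ^ 2 := by nlinarith [mul_nonneg (sq_nonneg S) (sub_nonneg.2 hC1)]
  nlinarith [mul_pos hS hS]
set_option maxHeartbeats 400000 in -- buildfix (bf3-g26): 160k/180k FAIL, 200k PASS at accept time; line-neutral budget line
/-- **The framing function of the first torus.**  For `T = Rechart f (S¹ × S¹)` with coordinates
`z₁`, `z₂` (`(z₁, z₂) = out p`), `0 < r₀ ≤ 1/8`, `ϑ = e^{i r₀}`, `ζ = z₁ ϑ²`, `S = sin r₀`, and the
quarter-chart directions `a₀ = Im z₁²/Re z₁² + i Im z₂²/Re z₂²` (at `x₂ = (1, 1)`),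
`a₁ = Im ζ²/Re ζ² + i Im z₂²/Re z₂²` (at `x₃ = (ϑ⁻², 1)`): there is `φ : T → ℂ`, smooth of norm
one off `x₂`, `x₃`, equal to `conj â₀` on `{Re z₁ ≥ 1 - S²/80, Re z₂ ≥ 1 - S²/80} ∖ {x₂}` and to
`â₁` on `{Re ζ ≥ 1 - S²/80, Re z₂ ≥ 1 - S²/80} ∖ {x₃}`.
[cite: AkhmedovPark2010, §3] [cite: Kirby1989, Ch. IV] -/
theorem exists_firstTorusFraming
    (hf : ContMDiff ((𝓡 1).prod (𝓡 1)) 𝓘(ℝ, EuclideanSpace ℝ (Fin 2)) ∞ f)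
    (hf' : ContMDiff 𝓘(ℝ, EuclideanSpace ℝ (Fin 2)) ((𝓡 1).prod (𝓡 1)) ∞ f.symm)
    {r₀ : ℝ} (hr₀ : 0 < r₀) (hr₀' : r₀ ≤ 1 / 8)
    {z₁ z₂ ζ : Rechart f (Circle × Circle) → Circle}
    (hz₁ : ∀ p, z₁ p = (Rechart.out f (Circle × Circle) p).1)
    (hz₂ : ∀ p, z₂ p = (Rechart.out f (Circle × Circle) p).2)
    (hζ : ∀ p, ζ p = z₁ p * Circle.exp r₀ ^ 2)
    {a₀ a₁ : Rechart f (Circle × Circle) → ℂ}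
    (ha₀ : ∀ p, a₀ p = (((((z₁ p : ℂ)) ^ 2).im / (((z₁ p : ℂ)) ^ 2).re : ℝ) : ℂ) +
      (((((z₂ p : ℂ)) ^ 2).im / (((z₂ p : ℂ)) ^ 2).re : ℝ) : ℂ) * I)
    (ha₁ : ∀ p, a₁ p = (((((ζ p : ℂ)) ^ 2).im / (((ζ p : ℂ)) ^ 2).re : ℝ) : ℂ) +
      (((((z₂ p : ℂ)) ^ 2).im / (((z₂ p : ℂ)) ^ 2).re : ℝ) : ℂ) * I) :
    ∃ φ : Rechart f (Circle × Circle) → ℂ,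
      ContMDiffOn (𝓡 2) 𝓘(ℝ, ℂ) ∞ φ
        {p | ¬ (z₁ p = 1 ∧ z₂ p = 1) ∧ ¬ (z₁ p = (Circle.exp r₀)⁻¹ ^ 2 ∧ z₂ p = 1)} ∧
      (∀ p, ¬ (z₁ p = 1 ∧ z₂ p = 1) → ¬ (z₁ p = (Circle.exp r₀)⁻¹ ^ 2 ∧ z₂ p = 1) →
        ‖φ p‖ = 1) ∧
      (∀ p, 1 - Real.sin r₀ ^ 2 / 80 ≤ (z₁ p : ℂ).re → 1 - Real.sin r₀ ^ 2 / 80 ≤ (z₂ p : ℂ).re →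
        ¬ (z₁ p = 1 ∧ z₂ p = 1) → φ p = conj (((‖a₀ p‖⁻¹ : ℝ) : ℂ) * a₀ p)) ∧
      (∀ p, 1 - Real.sin r₀ ^ 2 / 80 ≤ (ζ p : ℂ).re → 1 - Real.sin r₀ ^ 2 / 80 ≤ (z₂ p : ℂ).re →
        ¬ (z₁ p = (Circle.exp r₀)⁻¹ ^ 2 ∧ z₂ p = 1) → φ p = ((‖a₁ p‖⁻¹ : ℝ) : ℂ) * a₁ p) := by
  haveI hT : IsManifold (𝓡 2) ∞ (Rechart f (Circle × Circle)) := Rechart.isManifold f _ hf hf'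
  haveI : Fact (Module.finrank ℝ ℂ = 1 + 1) := finrank_real_complex_fact'
  obtain ⟨hS, hS8, hC, hC1, hϑre, hϑim, hϑ2re, hϑ2im⟩ := smallAngle_facts hr₀ hr₀'
  set Sr := Real.sin r₀ with hSr
  set Cr := Real.cos r₀ with hCr
  set ϑ : Circle := Circle.exp r₀ with hϑ
  -- notation
  set g : Rechart f (Circle × Circle) → ℂ := fun p =>
    ((z₂ p : ℂ) - 1) + ((((z₁ p : ℂ) * (ϑ : ℂ)).re - (ϑ : ℂ).re : ℝ) : ℂ) with hg
  let unit : ℂ → ℂ := fun z => ((‖z‖⁻¹ : ℝ) : ℂ) * z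
  set Sset : Set (Rechart f (Circle × Circle)) :=
    {p | ¬ (z₁ p = 1 ∧ z₂ p = 1) ∧ ¬ (z₁ p = ϑ⁻¹ ^ 2 ∧ z₂ p = 1)} with hSset
  -- smoothness of the coordinates
  have hout : ContMDiff (𝓡 2) ((𝓡 1).prod (𝓡 1)) ∞ (Rechart.out f (Circle × Circle)) :=
    Rechart.contMDiff_out f _ hf hf'
  have hcoe : ContMDiff (𝓡 1) 𝓘(ℝ, ℂ) ∞ (fun z : Circle => (z : ℂ)) := contMDiff_coe_sphere
  have hz₁C : ContMDiff (𝓡 2) (𝓡 1) ∞ z₁ := by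
    have : z₁ = Prod.fst ∘ Rechart.out f (Circle × Circle) := funext fun p => hz₁ p
    rw [this]; exact contMDiff_fst.comp hout
  have hz₂C : ContMDiff (𝓡 2) (𝓡 1) ∞ z₂ := by
    have : z₂ = Prod.snd ∘ Rechart.out f (Circle × Circle) := funext fun p => hz₂ p
    rw [this]; exact contMDiff_snd.comp hout
  have hζC : ContMDiff (𝓡 2) (𝓡 1) ∞ ζ := by
    have : ζ = fun p => z₁ p * ϑ ^ 2 := funext fun p => hζ p
    rw [this]; exact hz₁C.mul contMDiff_const
  have hz₁c : ContMDiff (𝓡 2) 𝓘(ℝ, ℂ) ∞ fun p => (z₁ p : ℂ) := hcoe.comp hz₁C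
  have hz₂c : ContMDiff (𝓡 2) 𝓘(ℝ, ℂ) ∞ fun p => (z₂ p : ℂ) := hcoe.comp hz₂C
  have hζc : ContMDiff (𝓡 2) 𝓘(ℝ, ℂ) ∞ fun p => (ζ p : ℂ) := hcoe.comp hζC
  have hofReal : ContMDiff 𝓘(ℝ, ℝ) 𝓘(ℝ, ℂ) ∞ (fun t : ℝ => (t : ℂ)) := Complex.ofRealCLM.contMDiff
  have hmulI : ContMDiff 𝓘(ℝ, ℝ) 𝓘(ℝ, ℂ) ∞ (fun t : ℝ => (t : ℂ) * I) :=
    (Complex.ofRealCLM.contDiff.mul contDiff_const).contMDiff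
  have hmulϑ : ContDiff ℝ ∞ fun z : ℂ => z * (ϑ : ℂ) := contDiff_id.mul contDiff_const
  have hsqC : ContDiff ℝ ∞ fun z : ℂ => z ^ 2 := contDiff_id.pow 2
  have hgs : ContMDiff (𝓡 2) 𝓘(ℝ, ℂ) ∞ g := by
    have h1 : ContMDiff (𝓡 2) 𝓘(ℝ, ℝ) ∞ fun p => ((z₁ p : ℂ) * (ϑ : ℂ)).re :=
      Complex.reCLM.contMDiff.comp (hmulϑ.comp_contMDiff hz₁c)
    exact (hz₂c.sub contMDiff_const).add (hofReal.comp (h1.sub contMDiff_const))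
  -- `ζ ϑ⁻¹ = z₁ ϑ`, used to read `g` in the variable `ζ`
  have hζϑ : ∀ p, ((ζ p : ℂ)) * (((ϑ⁻¹ : Circle)) : ℂ) = (z₁ p : ℂ) * (ϑ : ℂ) := fun p => by
    rw [← Circle.coe_mul, ← Circle.coe_mul, hζ p]
    congr 1
    rw [sq, mul_assoc, mul_assoc, mul_inv_cancel, mul_one]
  have hz₁ζ : ∀ p, z₁ p = ζ p * (ϑ ^ 2)⁻¹ := fun p => by rw [hζ p, mul_inv_cancel_right]
  -- the zero set of `g`
  have hg0 : ∀ p, g p = 0 ↔ ¬ (p ∈ Sset) := fun p => by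
    show ((z₂ p : ℂ) - 1) + ((((z₁ p : ℂ) * (ϑ : ℂ)).re - (ϑ : ℂ).re : ℝ) : ℂ) = 0 ↔ ¬ (p ∈ Sset)
    rw [hϑ, BraidFraming.refFramingFirst_eq_zero_iff (by rw [← hCr]; linarith), ← hϑ]
    simp only [hSset, mem_setOf_eq]
    constructor
    · rintro ⟨h1, h2 | h2⟩ ⟨h3, h4⟩
      · exact h3 ⟨h2, h1⟩
      · exact h4 ⟨h2, h1⟩
    · intro h
      by_contra h'
      exact h ⟨fun h3 => h' ⟨h3.2, Or.inl h3.1⟩, fun h3 => h' ⟨h3.2, Or.inr h3.1⟩⟩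
  have hgne : ∀ p ∈ Sset, g p ≠ 0 := fun p hp h => (hg0 p).1 h hp
  -- the reference unit framing
  have hΦ : ContMDiffOn (𝓡 2) 𝓘(ℝ, ℂ) ∞ (fun p => unit (g p)) Sset := fun p hp =>
    ((BraidedTorus.contDiffAt_unit (hgne p hp)).comp_contMDiffWithinAt (hgs p).contMDiffWithinAt)
  have hΦ1 : ∀ p ∈ Sset, ‖unit (g p)‖ = 1 := fun p hp =>
    (unit_mul_facts (w := g p) (hgne p hp)).1
  -- the directions `a₀`, `a₁`
  have hdiv : ContDiffOn ℝ ∞ (fun w : ℂ => w.im / w.re) {w : ℂ | w.re ≠ 0} :=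
    Complex.imCLM.contDiff.contDiffOn.div Complex.reCLM.contDiff.contDiffOn fun w hw => hw
  set B₀ : Set (Rechart f (Circle × Circle)) :=
    {p | (((z₁ p : ℂ)) ^ 2).re ≠ 0 ∧ (((z₂ p : ℂ)) ^ 2).re ≠ 0} with hB₀
  set B₁ : Set (Rechart f (Circle × Circle)) :=
    {p | (((ζ p : ℂ)) ^ 2).re ≠ 0 ∧ (((z₂ p : ℂ)) ^ 2).re ≠ 0} with hB₁
  have hqc : ∀ {h : Rechart f (Circle × Circle) → ℂ} {Bs : Set (Rechart f (Circle × Circle))},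
      ContMDiff (𝓡 2) 𝓘(ℝ, ℂ) ∞ h → (∀ p ∈ Bs, ((h p) ^ 2).re ≠ 0) →
      ContMDiffOn (𝓡 2) 𝓘(ℝ, ℝ) ∞ (fun p => ((h p) ^ 2).im / ((h p) ^ 2).re) Bs :=
    fun hh hB => hdiv.contMDiffOn.comp (hsqC.comp_contMDiff hh).contMDiffOn fun p hp => hB p hp
  have ha₀s : ContMDiffOn (𝓡 2) 𝓘(ℝ, ℂ) ∞ a₀ B₀ :=
    ((hofReal.comp_contMDiffOn (hqc hz₁c fun p hp => hp.1)).add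
      (hmulI.comp_contMDiffOn (hqc hz₂c fun p hp => hp.2))).congr fun p _ => ha₀ p
  have ha₁s : ContMDiffOn (𝓡 2) 𝓘(ℝ, ℂ) ∞ a₁ B₁ :=
    ((hofReal.comp_contMDiffOn (hqc hζc fun p hp => hp.1)).add
      (hmulI.comp_contMDiffOn (hqc hz₂c fun p hp => hp.2))).congr fun p _ => ha₁ p
  -- circle bookkeeping
  have hsq1 : ∀ w : Circle, (w : ℂ).re ^ 2 + (w : ℂ).im ^ 2 = 1 := fun w =>
    BraidFraming.re_sq_add_im_sq w
  have hReBig : ∀ {w : Circle}, 19 / 20 < (w : ℂ).re → 0 < (((w : ℂ)) ^ 2).re := fun {w} hw => by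
    rw [BraidFraming.sq_re]; nlinarith [hsq1 w]
  have hImSmall : ∀ {w : Circle}, 1 - Sr ^ 2 / 40 ≤ (w : ℂ).re → |(w : ℂ).im| < Sr / 4 := by
    intro w hw
    have h := hsq1 w
    have hre1 : (w : ℂ).re ≤ 1 := by nlinarith
    have him2 : (w : ℂ).im ^ 2 < (Sr / 4) ^ 2 := by nlinarith
    obtain ⟨h1, h2⟩ := abs_lt_of_sq_lt_sq' him2 (by positivity)
    exact abs_lt.2 ⟨h1, h2⟩
  -- zeros of a quarter direction: both imaginary parts of the squares vanish
  have hdir0 : ∀ {w₁ w₂ : Circle}, 19 / 20 < (w₁ : ℂ).re → 19 / 20 < (w₂ : ℂ).re →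
      ((((((w₁ : ℂ)) ^ 2).im / (((w₁ : ℂ)) ^ 2).re : ℝ) : ℂ) +
        (((((w₂ : ℂ)) ^ 2).im / (((w₂ : ℂ)) ^ 2).re : ℝ) : ℂ) * I) = 0 → w₁ = 1 ∧ w₂ = 1 := by
    intro w₁ w₂ h1 h2 h
    have hre := congrArg Complex.re h
    have him := congrArg Complex.im h
    simp only [Complex.add_re, Complex.ofReal_re, Complex.mul_re, Complex.I_re, Complex.I_im,
      Complex.ofReal_im, Complex.add_im, Complex.mul_im, Complex.zero_re, Complex.zero_im,
      mul_zero, mul_one, zero_add, add_zero, sub_self] at hre him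
    have hX1 := hReBig h1
    have hX2 := hReBig h2
    have e1 : (((w₁ : ℂ)) ^ 2).im = 0 := by
      rcases div_eq_zero_iff.1 hre with h | h
      · exact h
      · exact absurd h hX1.ne'
    have e2 : (((w₂ : ℂ)) ^ 2).im = 0 := by
      rcases div_eq_zero_iff.1 him with h | h
      · exact h
      · exact absurd h hX2.ne'
    rw [BraidFraming.sq_im] at e1 e2
    have i1 : (w₁ : ℂ).im = 0 := by
      rcases mul_eq_zero.1 e1 with h | h
      · rcases mul_eq_zero.1 h with h' | h'
        · norm_num at h'
        · linarith
      · exact h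
    have i2 : (w₂ : ℂ).im = 0 := by
      rcases mul_eq_zero.1 e2 with h | h
      · rcases mul_eq_zero.1 h with h' | h'
        · norm_num at h'
        · linarith
      · exact h
    exact ⟨BraidFraming.eq_one_of_im_eq_zero i1 (by linarith),
      BraidFraming.eq_one_of_im_eq_zero i2 (by linarith)⟩
  -- `Sset` is open
  have hSo : IsOpen Sset := by
    have : Sset = g ⁻¹' {0}ᶜ := by
      ext p
      simp only [mem_preimage, mem_compl_iff, mem_singleton_iff]
      constructor
      · exact fun hp h => (hg0 p).1 h hp
      · intro h; by_contra hp; exact h ((hg0 p).2 hp)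
    rw [this]
    exact isOpen_compl_singleton.preimage hgs.continuous
  -- the boxes
  have hre₁ : Continuous fun p => (z₁ p : ℂ).re := Complex.continuous_re.comp hz₁c.continuous
  have him₁ : Continuous fun p => (z₁ p : ℂ).im := Complex.continuous_im.comp hz₁c.continuous
  have hre₂ : Continuous fun p => (z₂ p : ℂ).re := Complex.continuous_re.comp hz₂c.continuous
  have hreζ : Continuous fun p => (ζ p : ℂ).re := Complex.continuous_re.comp hζc.continuous
  have himζ : Continuous fun p => (ζ p : ℂ).im := Complex.continuous_im.comp hζc.continuous
  set V₂ : Set (Rechart f (Circle × Circle)) :=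
    {p | 19 / 20 < (z₁ p : ℂ).re ∧ |(z₁ p : ℂ).im| < Sr / 4 ∧ 19 / 20 < (z₂ p : ℂ).re} ∩ Sset
    with hV₂
  set V₃ : Set (Rechart f (Circle × Circle)) :=
    {p | 19 / 20 < (ζ p : ℂ).re ∧ |(ζ p : ℂ).im| < Sr / 4 ∧ 19 / 20 < (z₂ p : ℂ).re} ∩ Sset
    with hV₃
  have habs₁ : Continuous fun p => |(z₁ p : ℂ).im| := continuous_abs.comp him₁
  have habsζ : Continuous fun p => |(ζ p : ℂ).im| := continuous_abs.comp himζ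
  have hV₂o : IsOpen V₂ :=
    ((isOpen_lt continuous_const hre₁).inter ((isOpen_lt habs₁ continuous_const).inter
      (isOpen_lt continuous_const hre₂))).inter hSo
  have hV₃o : IsOpen V₃ :=
    ((isOpen_lt continuous_const hreζ).inter ((isOpen_lt habsζ continuous_const).inter
      (isOpen_lt continuous_const hre₂))).inter hSo
  have hV₂B : V₂ ⊆ B₀ := by
    rintro p ⟨⟨h1, -, h2⟩, -⟩; exact ⟨(hReBig h1).ne', (hReBig h2).ne'⟩
  have hV₃B : V₃ ⊆ B₁ := by
    rintro p ⟨⟨h1, -, h2⟩, -⟩; exact ⟨(hReBig h1).ne', (hReBig h2).ne'⟩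
  have ha₀V : ∀ p ∈ V₂, a₀ p ≠ 0 := by
    rintro p ⟨⟨h1, -, h2⟩, hpS⟩ h0
    rw [ha₀ p] at h0
    exact hpS.1 (hdir0 h1 h2 h0)
  have ha₁V : ∀ p ∈ V₃, a₁ p ≠ 0 := by
    rintro p ⟨⟨h1, -, h2⟩, hpS⟩ h0
    rw [ha₁ p] at h0
    obtain ⟨e1, e2⟩ := hdir0 h1 h2 h0
    refine hpS.2 ⟨?_, e2⟩
    rw [hz₁ζ p, e1, one_mul, inv_pow]
  -- the targets
  have hunit : ∀ {z : ℂ}, z ≠ 0 → ContDiffAt ℝ ∞ unit z := fun hz => BraidedTorus.contDiffAt_unit hz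
  have hu₂ : ContMDiffOn (𝓡 2) 𝓘(ℝ, ℂ) ∞ (fun p => conj (unit (a₀ p))) V₂ := fun p hp =>
    (Complex.conjCLE.contDiff.contDiffAt.comp _ (hunit (ha₀V p hp))).comp_contMDiffWithinAt
      ((ha₀s p (hV₂B hp)).mono hV₂B)
  have hu₃ : ContMDiffOn (𝓡 2) 𝓘(ℝ, ℂ) ∞ (fun p => unit (a₁ p)) V₃ := fun p hp =>
    (hunit (ha₁V p hp)).comp_contMDiffWithinAt ((ha₁s p (hV₃B hp)).mono hV₃B)
  have hu₂1 : ∀ p ∈ V₂, ‖conj (unit (a₀ p))‖ = 1 := fun p hp => by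
    rw [Complex.norm_conj]; exact (unit_mul_facts (w := a₀ p) (ha₀V p hp)).1
  have hu₃1 : ∀ p ∈ V₃, ‖unit (a₁ p)‖ = 1 := fun p hp =>
    (unit_mul_facts (w := a₁ p) (ha₁V p hp)).1
  -- phase conditions
  have hexpπ : Complex.exp (-(π * I)) = -1 := by
    rw [Complex.exp_neg, Complex.exp_pi_mul_I]; norm_num
  have hre₂φ : ∀ p ∈ V₂, 0 < (conj (unit (a₀ p)) * conj (unit (g p)) * Complex.exp (-(π * I))).re := by
    rintro p ⟨⟨h1, hi, h2⟩, hpS⟩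
    have ha := ha₀V p ⟨⟨h1, hi, h2⟩, hpS⟩
    have hgp := hgne p hpS
    obtain ⟨-, hconj, -⟩ := unit_mul_facts (w := g p) ha
    have hE := BraidFraming.re_quarterCoord_mul_refFraming_neg (r₀ := r₀) hS (by linarith)
      (z₁ := z₁ p) (z₂ := z₂ p) h1.le hi.le h2.le hpS.1
    have hE' : (a₀ p * g p).re < 0 := by rw [ha₀ p]; exact hE
    rw [hexpπ, hconj, mul_neg_one, Complex.neg_re, Complex.re_ofReal_mul, Complex.conj_re]
    have hpos : 0 < (‖a₀ p‖ * ‖g p‖)⁻¹ :=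
      inv_pos.2 (mul_pos (norm_pos_iff.2 ha) (norm_pos_iff.2 hgp))
    have : (‖a₀ p‖ * ‖g p‖)⁻¹ * (a₀ p * g p).re < 0 := mul_neg_of_pos_of_neg hpos hE'
    linarith
  have hre₃φ : ∀ p ∈ V₃, 0 < (unit (a₁ p) * conj (unit (g p)) * Complex.exp (-(0 * I))).re := by
    rintro p ⟨⟨h1, hi, h2⟩, hpS⟩
    have ha := ha₁V p ⟨⟨h1, hi, h2⟩, hpS⟩
    have hgp := hgne p hpS
    obtain ⟨-, -, hmul⟩ := unit_mul_facts (w := g p) ha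
    have hne' : ¬ (ζ p = 1 ∧ z₂ p = 1) := fun h => by
      refine hpS.2 ⟨?_, h.2⟩
      rw [hz₁ζ p, h.1, one_mul, inv_pow]
    have hE := BraidFraming.re_quarterCoord_mul_conj_refFraming_pos (r₀ := r₀) hS (by linarith)
      (ζ := ζ p) (z₂ := z₂ p) h1.le hi.le h2.le hne'
    have hgζ : g p = ((z₂ p : ℂ) - 1) +
        (((((ζ p : ℂ)) * (((Circle.exp r₀)⁻¹ : Circle) : ℂ)).re -
          ((Circle.exp r₀ : Circle) : ℂ).re : ℝ) : ℂ) := by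
      show ((z₂ p : ℂ) - 1) + ((((z₁ p : ℂ) * (ϑ : ℂ)).re - (ϑ : ℂ).re : ℝ) : ℂ) = _
      rw [← hϑ, hζϑ p]
    have hE' : 0 < (a₁ p * conj (g p)).re := by rw [ha₁ p, hgζ]; exact hE
    rw [zero_mul, neg_zero, Complex.exp_zero, mul_one, hmul, Complex.re_ofReal_mul]
    have hpos : 0 < (‖a₁ p‖ * ‖g p‖)⁻¹ :=
      inv_pos.2 (mul_pos (norm_pos_iff.2 ha) (norm_pos_iff.2 hgp))
    exact mul_pos hpos hE'
  -- the bumps, with levels `cin = 1 - S²/80`, `cout = 1 - S²/40`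
  have hlev : (1 : ℝ) - Sr ^ 2 / 40 < 1 - Sr ^ 2 / 80 := by nlinarith
  have hre1 : ∀ p, ((((Rechart.out f (Circle × Circle) p).1 * (1 : Circle)⁻¹ : Circle)) : ℂ).re =
      (z₁ p : ℂ).re ∧
      ((((Rechart.out f (Circle × Circle) p).2 * (1 : Circle)⁻¹ : Circle)) : ℂ).re = (z₂ p : ℂ).re :=
    fun p => by rw [inv_one, mul_one, mul_one, hz₁ p, hz₂ p]; exact ⟨rfl, rfl⟩
  have hre3 : ∀ p, ((((Rechart.out f (Circle × Circle) p).1 * (ϑ⁻¹ ^ 2)⁻¹ : Circle)) : ℂ).re =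
      (ζ p : ℂ).re ∧
      ((((Rechart.out f (Circle × Circle) p).2 * (1 : Circle)⁻¹ : Circle)) : ℂ).re = (z₂ p : ℂ).re :=
    fun p => by
      constructor
      · rw [inv_pow, inv_inv, hζ p, hz₁ p]
      · rw [inv_one, mul_one, hz₂ p]
  obtain ⟨β₂, hβ₂, -, hβ₂1, -, hβ₂s⟩ := exists_torusBump hf hf' (1 : Circle) (1 : Circle) hlev
  obtain ⟨β₃, hβ₃, -, hβ₃1, -, hβ₃s⟩ := exists_torusBump hf hf' (ϑ⁻¹ ^ 2) (1 : Circle) hlev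
  have hβ₂s' : ∀ p ∈ tsupport β₂, 1 - Sr ^ 2 / 40 ≤ (z₁ p : ℂ).re ∧ 1 - Sr ^ 2 / 40 ≤ (z₂ p : ℂ).re :=
    fun p hp => by
      obtain ⟨h1, h2⟩ := hβ₂s hp
      obtain ⟨e1, e2⟩ := hre1 p
      exact ⟨by rwa [e1] at h1, by rwa [e2] at h2⟩
  have hβ₃s' : ∀ p ∈ tsupport β₃, 1 - Sr ^ 2 / 40 ≤ (ζ p : ℂ).re ∧ 1 - Sr ^ 2 / 40 ≤ (z₂ p : ℂ).re :=
    fun p hp => by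
      obtain ⟨h1, h2⟩ := hβ₃s hp
      obtain ⟨e1, e2⟩ := hre3 p
      exact ⟨by rwa [e1] at h1, by rwa [e2] at h2⟩
  have hβ₂V : ∀ p ∈ Sset, p ∈ tsupport β₂ → p ∈ V₂ := fun p hp hp' => by
    obtain ⟨h1, h2⟩ := hβ₂s' p hp'
    exact ⟨⟨by nlinarith, hImSmall h1, by nlinarith⟩, hp⟩
  have hβ₃V : ∀ p ∈ Sset, p ∈ tsupport β₃ → p ∈ V₃ := fun p hp hp' => by
    obtain ⟨h1, h2⟩ := hβ₃s' p hp'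
    exact ⟨⟨by nlinarith, hImSmall h1, by nlinarith⟩, hp⟩
  -- a point near `x₃` is far from `x₂` and conversely: `Im z₁ = Im ζ cos 2r₀ - Re ζ sin 2r₀`
  have hImz₁ : ∀ p, (z₁ p : ℂ).im =
      (ζ p : ℂ).im * (1 - 2 * Sr ^ 2) - (ζ p : ℂ).re * (2 * Sr * Cr) := by
    intro p
    have h : (z₁ p : ℂ) = (ζ p : ℂ) * ((((ϑ ^ 2)⁻¹ : Circle)) : ℂ) := by
      rw [← Circle.coe_mul, ← hz₁ζ p]
    rw [h, Circle.coe_inv_eq_conj, Complex.mul_im, Complex.conj_re, Complex.conj_im, hϑ2re, hϑ2im]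
    ring
  have hReζ : ∀ p, (ζ p : ℂ).re =
      (z₁ p : ℂ).re * (1 - 2 * Sr ^ 2) - (z₁ p : ℂ).im * (2 * Sr * Cr) := by
    intro p
    have h : (ζ p : ℂ) = (z₁ p : ℂ) * (((ϑ ^ 2 : Circle)) : ℂ) := by rw [hζ p, Circle.coe_mul]
    rw [h, Complex.mul_re, hϑ2re, hϑ2im]
  have hfar₃ : ∀ p ∈ V₃, p ∉ tsupport β₂ := by
    rintro p ⟨⟨h1, hi, -⟩, -⟩ hp
    obtain ⟨hz, -⟩ := hβ₂s' p hp
    have hsmall := hImSmall hz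
    have him := hImz₁ p
    have hi' := abs_lt.1 hi
    have hs' := abs_lt.1 hsmall
    -- `Im z₁ ≤ S/4 - (19/20)·2 S C < -S/4`
    nlinarith [mul_pos hS (by linarith : (0:ℝ) < Cr)]
  have hfar₂ : ∀ p, 1 - Sr ^ 2 / 80 ≤ (z₁ p : ℂ).re → p ∉ tsupport β₃ := by
    intro p h1 hp
    obtain ⟨hz, -⟩ := hβ₃s' p hp
    have hsmall := hImSmall (le_trans hlev.le h1)
    have hle1 : (z₁ p : ℂ).re ≤ 1 := by nlinarith [hsq1 (z₁ p)]
    exact far_from_third_arith hS hS8 (by linarith) hC1 hle1 hsmall (hReζ p) hz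
  -- the two-point correction
  obtain ⟨φ, hφ, hφ1, hφ₂, hφ₃, -⟩ := exists_two_point_framing (IM := 𝓡 2) hV₂o hV₃o
    inter_subset_right inter_subset_right hΦ hΦ1 hu₂ hu₂1 π hre₂φ hu₃ hu₃1 0 hre₃φ hβ₂ hβ₃
    hβ₂V hβ₃V hfar₃
  refine ⟨φ, hφ, fun p h1 h2 => hφ1 p ⟨h1, h2⟩, fun p h1 h2 hne => ?_, fun p h1 h2 hne => ?_⟩
  · -- the `x₂` box
    have hi := hImSmall (le_trans hlev.le h1)
    have hpS : p ∈ Sset := ⟨hne, not_third_point_of_re_ge hS hϑ2re h1⟩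
    have hpV : p ∈ V₂ := ⟨⟨by nlinarith, hi, by nlinarith⟩, hpS⟩
    obtain ⟨e1, e2⟩ := hre1 p
    have hβ : β₂ p = 1 := hβ₂1 p (by rw [e1]; exact h1) (by rw [e2]; exact h2)
    exact hφ₂ p hpV hβ (hfar₂ p h1)
  · -- the `x₃` box
    have hi := hImSmall (le_trans hlev.le h1)
    have hpS : p ∈ Sset := ⟨not_second_point_of_re_ge hS hϑ2re (hζ p) h1, hne⟩
    have hpV : p ∈ V₃ := ⟨⟨by nlinarith, hi, by nlinarith⟩, hpS⟩
    obtain ⟨e1, e2⟩ := hre3 p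
    have hβ : β₃ p = 1 := hβ₃1 p (by rw [e1]; exact h1) (by rw [e2]; exact h2)
    exact hφ₃ p hpV hβ

end First

end Literature.Topology.FourManifolds
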